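/-
Copyright (c) 2026 the pub-hodgecm-mathlib formalisation cell (harness21).  Prover seat hodgecm-mathlib-R90-C10-p04 (g2), SLAB R90-TF, section S1 «Ch. 10∕12 local»,
cell «U4-RAM :182 B_pos» (line (D-1) of R90-C10-p05 (g2), L4 dealer K2E3-plan (g5)): brick (B-4), PART 2 «THE SKEW-LINE CHARACTER INTEGRALS AT POSITIVE DEPTH» for the
U4Keys socket :182 (ramified `χ₁` of positive depth, Branch B) = S1 A2′, crux H413 = `stmt-HodgeConjecture-24833`.  KERNEL module: THEOREMS ONLY (no definition, no named
fact, no `sorry`, no instance, no notation).  2026-09-05.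
-/
import Summits.HodgeConjecture.HodgeConjecture.Theorems.R90S1BposSkewBallCharacterTools   -- ★ (B-4) PART 1 (this seat): §1 orthogonality on an invariant set, §2 product decomposition, §3 constancy of the fibre, §0 ball topology; brings ★ (II)-b2∕(II)-b3a∕(II)-b1 and ★ `InvolutionRingFixedDecomposition`
import HarnessLib

/-!
# R90 · S1 ∕ U4Keys leaf (U4f-χ₁-ram-one-pos), BRANCH B — brick (B-4), PART 2: THE SKEW-LINE CHARACTER INTEGRALS AT POSITIVE DEPTH
# `∫_{y ∈ R⁻, |y|_w ≤ |ρ|_w} χ₁((1 + y)^) dμ⁻(y) = 0` as soon as `χ₁` is non-trivial on the principal units `1 + ρ𝒪`, and `∫_{|y|_w ≤ 1} χ₁((1 + y)^) dμ⁻ = 0` as soon as `χ₁` has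
# positive depth   [Keys1984 §4–§5, §7 Thm (2); WeilBNT1967 Ch. II §5; Roche1998 §3–§4; Rogawski1990 §12.2 (2)]

Cell `pub/hodgecm-mathlib` (D-0151), SLAB R90-TF, section S1 «Ch. 10∕12 local», crux H413 = `stmt-HodgeConjecture-24833` (lane `--supports … --as helper`), route of record
`HCCMUnconditional` (no route verbs); prover seat `hodgecm-mathlib-R90-C10-p04` (g2), hand (B-4) of the B_pos line (D-1) led by R90-C10-p05 (g2) (memo `R90/R90-C10-p05/g2/DESIGN-Bpos-inert.md`
f70d293d60bf8a4b §3 ∕ §5 (B-4); S1 chair R-S1-12 (2) 2026-09-04T23:23:05Z; R90-C10-audit1 (g2) R0 SANITY 23:18:42Z pin (b)).  THEOREMS ONLY (no `def`, no `instance`, no notation, no named-fact hypothesis, no `sorry`); ★-only imports (no `Lines`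
import).  NOT THE PAYER of :182: this is the ONE analytic input of the positive-depth Casselman pair beyond the depth-zero programme (p05 (g2) R0: «the ONLY analytic input beyond
d0B is `∫_{u ∈ E⁻, |u| ≤ |ϖ|^m} χ₁(1+u) du = μ(E⁻_m)·𝟙[m ≥ n]`»); the shell sums `G₁, G₂`, the type plane at `J_e` and the assembly are the line's other bricks.

FRAME (= ★ (II)-b2∕(II)-b3a v1 spellings, this seat's g0 lineage; PART 1 ★ `R90S1BposSkewBallCharacterTools`): `R := LocalRing L v = L ⊗ L⁺_v` at a NON-SPLIT place `v`
(`hw : c • w = w` for the place `w ∣ v`) with `v ∤ 2` (`h2w : |2|_w = 1`); `σ := conjLocal L c v`, `R⁻ = HeisRing.skewPart σ` (★ `InvolutionRingFixedDecomposition`); `χ₁ : Rˣ →* ℂˣ`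
continuous; `E r := χ₁(r̂)` if `r` is a unit, `0` otherwise (inline `dite`, ★ (II)-b3a's spelling); `μ⁻ = μY` ANY regular additive Haar measure on `R⁻` (Borel structure induced
from `R`).  The Branch-B letter is carried in its INERT form `hfix` «`χ₁ u = 1` for every `σ`-fixed unit `u` with `|u_{w′}| = 1`» (memo §5 (B-4) «`hB`-inert form»; = ★
`K2E3KeysThmTwoDepthZeroBranchBConversion.apply_eq_one_of_branchB_of_fixed (hns hunr χ₁ hB)` at an inert place).  RADII are carried by ELEMENTS: the ball of `R⁻` of radius `|ρ|_w`
is `{y | |y_w| ≤ |ρ_w|}` for a `ρ : R` with `0 < |ρ_w| < 1` (consumers take `ρ = ϖ̂ᵐ`, `1 ≤ m`); the DEPTH WITNESS is a unit `u₀` with `|(u₀ − 1)_w| ≤ |ρ_w|` (resp. `< 1`) and `χ₁ u₀ ≠ 1`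
(memo's `hcond_sharp : ∃ u, |u − 1| ≤ |ϖ|^{n−1} ∧ χ₁ u ≠ 1` gives it for every `m ≤ n − 1`; `hcond_n` gives the trivial case (ii) for `m ≥ n`).  NO `hdepth`, NO `hram`, NO conductor
bookkeeping inside: the statements are «non-trivial at level `ρ` ⟹ the ball integral of radius `|ρ|` vanishes», «trivial at level `ρ` ⟹ it is the mass», «positive depth ⟹ the
unit-ball integral vanishes».

THE POINT.  In the positive-depth Casselman pair of the B_pos line (Roche's level group `J_e`, memo §3) every shell of the entries reduces, by the Heisenberg chart `z = a + y`
(`a` FIXED, `y` SKEW, `|a + y|_w = max(|a|_w, |y|_w)` ★ `valued_add_apply_eq_max`), to skew-ball character integrals `Φ_ρ := ∫_{|y|_w ≤ |ρ|_w} E(1 + y) dμ⁻` (memo §3: «`∫_{E⁻_m} λ(1+u) du =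
vol(E⁻_m)·𝟙[m ≥ n]` (m ≥ 1)», «`m = 0`: `= 0` for `n ≥ 2`»): `Φ_ρ = 0` when `χ₁` is non-trivial on `1 + ρ𝒪_E` (§4 (i)), `Φ_ρ = μ⁻(ball)` when it is trivial there (§4 (ii)), and
`Φ₁ := ∫_{|y| ≤ 1} E(1+y) dμ⁻ = 0` when `χ₁` has positive depth (§4 (iii); at depth ZERO instead `Φ₁ = −χ₁(δ₀)·μ⁻(𝔪⁻)`, ★ (II)-b2 — the `n = 1` case).  PROOF (residue-field-free, no Cayley
transform, no bijection `(u, f) ↦ (1+u)(1+f)`): the depth-0 road of ★ (II)-b2 with the unit sphere replaced by a `u₀`-INVARIANT set, run on the three tools of PART 1 ★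
`R90S1BposSkewBallCharacterTools` (§1 orthogonality on an invariant set, §2 product decomposition through `R = R⁺ ⊕ R⁻`, §3 constancy of the fibre — the one use of `hfix`):
* (i) `A := {b : |(b − 1)_w| ≤ |ρ|_w} = (1 + ρ𝒪⁺) ⊕ ρ𝒪⁻` is `u₀`-invariant (`u₀b − 1 = u₀(b − 1) + (u₀ − 1)`) ⟹ `0 = μ⁺{|a − 1| ≤ |ρ|}·Φ_ρ` for the additive Haar measure
  `μ⁺ := μ⁻ ∘ (δ·)⁻¹` of `R⁺` (★ `mulSkewUnit`, `δ` a skew unit ★ `exists_conjLocal_skew_unit`); that ball is open (`|ρ| ≠ 0`), non-empty (`∋ 1`), relatively compact ⟹ **`Φ_ρ = 0`**.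
* (iii) `A′ := {b : |b_w| ≤ 1, |(b + σb)_w| = 1} = 𝒪⁺ˣ ⊕ 𝒪⁻` is invariant under `u₀ = 1 + t`, `|t|_w < 1` (`u₀b + σ(u₀b) = (b + σb) + (tb + σ(tb))`, `|tb + σ(tb)|_w < 1`); with
  `(a + y) + σ(a + y) = 2a` and §3 at radius `|1| = 1`: `0 = μ⁺{|a| = 1}·Φ₁` ⟹ **`Φ₁ = 0`**.  (ii) is `E(1 + y) = χ₁(u) = 1` on the ball (`u = 1 + y`, `|u − 1| = |y| ≤ |ρ|`).
* §5 the `χ₁⁻¹` readings (the (II)-b2 head integrates `χ₁((1+y)^)⁻¹`; the memo's integrands carry `χ₁(σz)⁻¹`): (i)(iii) applied to `χ₁⁻¹` (`inv_letters`: the letters are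
  inversion-stable).
MAIN HEADS: §4 **`setIntegral_skewBall_dite_one_add_eq_zero_of_level`** (i), `setIntegral_skewBall_dite_one_add_eq_measureReal_of_trivial` (ii),
**`setIntegral_skewUnitBall_dite_one_add_eq_zero_of_posDepth`** (iii); §5 `setIntegral_skewBall_diteInv_one_add_eq_zero_of_level`, `setIntegral_skewUnitBall_diteInv_one_add_eq_zero_of_posDepth`.
HONEST LABEL.  HC_CM is proved only modulo the 7 printed citations (2 remaining named inputs: hLiu418 = `stmt-HodgeConjecture-24832`, h413 = `stmt-HodgeConjecture-24833`) until rung 0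
closes; count-neutral — this file does NOT pay :182 (nor :155); no printed citation is discharged; REL ≠ ★ ≠ BUILT.

## References
* [Keys1984] D. Keys, *Principal series representations of special unitary groups over local fields*, Compositio Math. 51 (1984), §4–§5 (the rank-one integrals over `E × F` at
  conductor `n`), §7 Theorem (2) p. 126 (`λ|_{F^×} = ω_{E∕F}`, `s = ½`).
* [WeilBNT1967] A. Weil, *Basic Number Theory* (1967), Ch. I §2–§4, Ch. II §5 (Haar measure under homotheties; orthogonality of a non-trivial character of a compact group).
* [Roche1998] A. Roche, *Types and Hecke algebras for principal series representations of split reductive p-adic groups*, Ann. Sci. ÉNS (4) 31 (1998), §3–§4 (the level groups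
  `J_χ` and the vanishing of the off-support shells by the depth of `χ`).
* [Rogawski1990] J. D. Rogawski, *Automorphic Representations of Unitary Groups in Three Variables*, Ann. of Math. Stud. 123 (1990), §1.10 p. 9 (`N`, `z + σz = −xσx`), §12.2 (2)
  p. 173.
-/

set_option autoImplicit false
-- the mandated namespace has the single-problem summit's repeated segment (`HodgeConjecture.HodgeConjecture`)
set_option linter.dupNamespace false

noncomputable section

open NumberField IsDedekindDomain MeasureTheory Measure Topology Set
open scoped NNReal ENNReal
open Literature.NumberTheory Literature.NumberTheory.Automorphic Literature.NumberTheory.Automorphic.UnitaryGroup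

namespace Summit.HodgeConjecture.HodgeConjecture.R90.S1.BposSkewLineCharacterIntegralDepth

open Summit.HodgeConjecture.HodgeConjecture.Cruxes.H413
open Summit.HodgeConjecture.HodgeConjecture.Cruxes.H413.K2E3BranchBSkewUnitSign
open Summit.HodgeConjecture.HodgeConjecture.Cruxes.H413.K2E3BranchBSkewLineIntegrals
open Summit.HodgeConjecture.HodgeConjecture.Cruxes.H413.K2E3BranchBSkewLineCharacterIntegral

variable (L : Type) [Field L] [NumberField L] [IsCMField L] (v : HeightOneSpectrum (𝓞 ↥(maximalRealSubfield L)))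
  (w : PlacesOver L v) (hw : IsCMField.complexConj L • w.1 = w.1)

open Summit.HodgeConjecture.HodgeConjecture.R90.S1.BposSkewBallCharacterTools

section SkewBall

variable [MeasurableSpace (LocalRing L v)] [BorelSpace (LocalRing L v)]
  (μY : Measure ↥(HeisRing.skewPart (conjLocal L (IsCMField.complexConj L) v))) [μY.IsAddHaarMeasure] [μY.Regular]

/-! ## §4 THE HEADS: the skew-ball character integrals at level `ρ` and at positive depth -/

open scoped Classical in
include hw in
omit [μY.IsAddHaarMeasure] [μY.Regular] in
/-- **(ii) TRIVIAL LEVEL — `∫_{|y|_w ≤ |ρ|_w} E(1 + y) dμ⁻ = μ⁻{|y|_w ≤ |ρ|_w}`** when `χ₁` is trivial on the principal units of level `ρ` (`|ρ|_w < 1`): on the ball `1 + y` is a unit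
`u` with `|u − 1|_w = |y|_w ≤ |ρ|_w`, so `E(1 + y) = χ₁(u) = 1`.  (The shells `m ≥ cond_E χ₁` of the positive-depth Casselman pair.) [cite: Keys1984, §4] [cite: WeilBNT1967, Ch. II §5] -/
theorem setIntegral_skewBall_dite_one_add_eq_measureReal_of_trivial (χ₁ : (LocalRing L v)ˣ →* ℂˣ)
    (ρ : LocalRing L v) (hρ1 : Valued.v (ρ w) < 1)
    (htriv : ∀ u : (LocalRing L v)ˣ, Valued.v (((u : LocalRing L v) - 1) w) ≤ Valued.v (ρ w) → χ₁ u = 1) :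
    ∫ y in {y : ↥(HeisRing.skewPart (conjLocal L (IsCMField.complexConj L) v)) | Valued.v ((y : LocalRing L v) w) ≤ Valued.v (ρ w)},
        (fun r : LocalRing L v => if h : IsUnit r then ((χ₁ h.unit : ℂˣ) : ℂ) else 0) (1 + (y : LocalRing L v)) ∂μY =
      (μY.real {y : ↥(HeisRing.skewPart (conjLocal L (IsCMField.complexConj L) v)) | Valued.v ((y : LocalRing L v) w) ≤ Valued.v (ρ w)} : ℂ) := by
  have hmeasB := measurableSet_skewBall L v w ρ
  have hpt : ∀ y ∈ {y : ↥(HeisRing.skewPart (conjLocal L (IsCMField.complexConj L) v)) | Valued.v ((y : LocalRing L v) w) ≤ Valued.v (ρ w)},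
      (fun r : LocalRing L v => if h : IsUnit r then ((χ₁ h.unit : ℂˣ) : ℂ) else 0) (1 + (y : LocalRing L v)) = 1 := by
    intro y hy
    have hy' : Valued.v ((y : LocalRing L v) w) < 1 := lt_of_le_of_lt hy hρ1
    have hv1 : Valued.v ((1 + (y : LocalRing L v)) w) = 1 := by
      rw [Pi.add_apply, Pi.one_apply]; exact Valuation.map_one_add_of_lt _ hy'
    have hU : IsUnit (1 + (y : LocalRing L v)) :=
      K2E3DepthZeroIwahoriCharacterCM.isUnit_of_apply_ne_zero L v w hw _ (fun h => by rw [h] at hv1; exact zero_ne_one (by rw [← hv1, map_zero]))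
    simp only [dif_pos hU]
    have hlev : Valued.v (((hU.unit : LocalRing L v) - 1) w) ≤ Valued.v (ρ w) := by
      rw [IsUnit.unit_spec, add_sub_cancel_left]; exact hy
    rw [htriv hU.unit hlev, Units.val_one]
  rw [setIntegral_congr_fun hmeasB hpt, setIntegral_const, Complex.real_smul, mul_one]

open scoped Classical in
include hw in
/-- **(i) THE SKEW-BALL CHARACTER INTEGRAL AT LEVEL `ρ` VANISHES — `∫_{y ∈ R⁻, |y|_w ≤ |ρ|_w} χ₁((1 + y)^) dμ⁻(y) = 0`** whenever `χ₁` is NON-TRIVIAL on the principal units of level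
`ρ` (a unit `u₀` with `|(u₀ − 1)_w| ≤ |ρ|_w` and `χ₁ u₀ ≠ 1`; `0 < |ρ|_w < 1`), for a continuous `χ₁` trivial on the `σ`-fixed units of absolute value one (`hfix` — at an INERT place in
BRANCH B this is ★ `apply_eq_one_of_branchB_of_fixed (hns hunr χ₁ hB)`), `|2|_w = 1`, and EVERY regular additive Haar measure `μ⁻` on `R⁻`.  (The shells `1 ≤ m < cond_E χ₁` of the
positive-depth Casselman pair; p05 (g2) R0: «`∫_{E⁻_m} λ(1+u) du = vol(E⁻_m)·𝟙[m ≥ n]`».)  PROOF: PART 1 §1 on the `u₀`-invariant set `A = {b : |(b − 1)_w| ≤ |ρ|_w}` (`u₀b − 1 = u₀(b − 1) +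
(u₀ − 1)`) for the Haar measure `(μ⁺ ⊗ μ⁻)∘ringDecomp⁻¹` (`μ⁺ := μ⁻ ∘ (δ·)⁻¹`, ★ `mulSkewUnit`, `δ` a skew unit ★ `exists_conjLocal_skew_unit`); §2 with `P = {|a − 1| ≤ |ρ|}`,
`Y = {|y| ≤ |ρ|}` (`|(a − 1) + y|_w = max(|a − 1|_w, |y|_w)`, ★ `valued_add_apply_eq_max`); §3 makes the fibre the constant `Φ_ρ`; so `0 = μ⁺(P)·Φ_ρ` with `P` open (`|ρ| ≠ 0`), non-empty
(`1 ∈ P`) and relatively compact, hence `0 < μ⁺(P) < ∞`. [cite: Keys1984, §4–§5, §7 Theorem (2) p. 126] [cite: WeilBNT1967, Ch. II §5] [cite: Roche1998, §3–§4] -/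
theorem setIntegral_skewBall_dite_one_add_eq_zero_of_level (h2w : Valued.v (2 : w.1.adicCompletion L) = 1)
    (χ₁ : (LocalRing L v)ˣ →* ℂˣ) (h₁ : Continuous fun x => ((χ₁ x : ℂˣ) : ℂ))
    (hfix : ∀ u : (LocalRing L v)ˣ, (∀ w' : PlacesOver L v, Valued.v ((u : LocalRing L v) w') = 1) →
      conjLocal L (IsCMField.complexConj L) v (u : LocalRing L v) = u → χ₁ u = 1)
    (ρ : LocalRing L v) (hρ0 : Valued.v (ρ w) ≠ 0) (hρ1 : Valued.v (ρ w) < 1)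
    (u₀ : (LocalRing L v)ˣ) (hu₀ : Valued.v (((u₀ : LocalRing L v) - 1) w) ≤ Valued.v (ρ w)) (hχ : χ₁ u₀ ≠ 1) :
    ∫ y in {y : ↥(HeisRing.skewPart (conjLocal L (IsCMField.complexConj L) v)) | Valued.v ((y : LocalRing L v) w) ≤ Valued.v (ρ w)},
        (fun r : LocalRing L v => if h : IsUnit r then ((χ₁ h.unit : ℂˣ) : ℂ) else 0) (1 + (y : LocalRing L v)) ∂μY = 0 := by
  letI : Invertible (2 : LocalRing L v) := (isUnit_two_localRing L v).invertible
  haveI : SecondCountableTopology (LocalRing L v) := secondCountableTopology_localRing (E := L) v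
  have hσc := continuous_conjLocal L (IsCMField.complexConj L) v
  haveI := HeisRing.locallyCompactSpace_fixedPart (conjLocal L (IsCMField.complexConj L) v) hσc
  haveI := HeisRing.locallyCompactSpace_skewPart (conjLocal L (IsCMField.complexConj L) v) hσc
  haveI : SecondCountableTopology ↥(HeisRing.fixedPart (conjLocal L (IsCMField.complexConj L) v)) := TopologicalSpace.Subtype.secondCountableTopology _
  haveI : SecondCountableTopology ↥(HeisRing.skewPart (conjLocal L (IsCMField.complexConj L) v)) := TopologicalSpace.Subtype.secondCountableTopology _
  -- names
  set E : LocalRing L v → ℂ := fun r : LocalRing L v => if h : IsUnit r then ((χ₁ h.unit : ℂˣ) : ℂ) else 0 with hEdef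
  set c : _ := Valued.v (ρ w) with hcdef
  set A : Set (LocalRing L v) := {b | Valued.v ((b - 1) w) ≤ c} with hAdef
  set P : Set ↥(HeisRing.fixedPart (conjLocal L (IsCMField.complexConj L) v)) := {a | Valued.v (((a : LocalRing L v) - 1) w) ≤ c} with hPdef
  set Y : Set ↥(HeisRing.skewPart (conjLocal L (IsCMField.complexConj L) v)) := {y | Valued.v ((y : LocalRing L v) w) ≤ c} with hYdef
  set Φ : ℂ := ∫ y in Y, E (1 + (y : LocalRing L v)) ∂μY with hΦdef
  -- valuation bookkeeping: a unit of level `c` has absolute value one, and level `c` is stable under such units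
  have hval1 : ∀ b : LocalRing L v, Valued.v ((b - 1) w) ≤ c → Valued.v (b w) = 1 := fun b hb => by
    have h : b w = 1 + (b - 1) w := by rw [Pi.sub_apply, Pi.one_apply, add_sub_cancel]
    rw [h]; exact Valuation.map_one_add_of_lt _ (lt_of_le_of_lt hb hρ1)
  have hstep : ∀ (u : (LocalRing L v)ˣ) (b : LocalRing L v), Valued.v (((u : LocalRing L v) - 1) w) ≤ c → Valued.v ((b - 1) w) ≤ c →
      Valued.v (((u : LocalRing L v) * b - 1) w) ≤ c := fun u b hu hb => by
    have h : ((u : LocalRing L v) * b - 1) w = (u : LocalRing L v) w * ((b - 1) w) + ((u : LocalRing L v) - 1) w := by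
      simp only [Pi.sub_apply, Pi.mul_apply, Pi.one_apply]; ring
    rw [h]
    refine (Valuation.map_add _ _ _).trans (max_le ?_ hu)
    rw [map_mul, hval1 _ hu, one_mul]; exact hb
  have hu₀inv : Valued.v ((((u₀⁻¹ : (LocalRing L v)ˣ) : LocalRing L v) - 1) w) ≤ c := by
    have h : (((u₀⁻¹ : (LocalRing L v)ˣ) : LocalRing L v) - 1) w = -((((u₀⁻¹ : (LocalRing L v)ˣ) : LocalRing L v) w) * (((u₀ : LocalRing L v) - 1) w)) := by
      have h1 := units_apply_mul_inv_apply L v u₀ w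
      simp only [Pi.sub_apply, Pi.one_apply]
      linear_combination h1
    rw [h, Valuation.map_neg, map_mul, valued_units_inv_apply_eq_one L v (hval1 _ hu₀), one_mul]; exact hu₀
  -- the set `A` is Borel, made of units of absolute value one, and `u₀`-invariant
  have hA : MeasurableSet A := by
    have h : A = (fun b : LocalRing L v => (b - 1) w) ⁻¹' {z : w.1.adicCompletion L | Valued.v z ≤ c} := rfl
    rw [h]
    exact ((isClosed_setOf_valued_le_valued L v w (ρ w)).preimage ((continuous_apply w).comp (continuous_id.sub continuous_const))).measurableSet
  have hA1 : ∀ b ∈ A, Valued.v (b w) = 1 := fun b hb => hval1 b hb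
  have hAu : ∀ b : LocalRing L v, (u₀ : LocalRing L v) * b ∈ A ↔ b ∈ A := fun b => by
    refine ⟨fun h => ?_, fun h => hstep u₀ b hu₀ h⟩
    have h' := hstep u₀⁻¹ ((u₀ : LocalRing L v) * b) hu₀inv h
    rwa [← mul_assoc, Units.inv_mul, one_mul] at h'
  have hu₀' : ∀ w' : PlacesOver L v, Valued.v ((u₀ : LocalRing L v) w') = 1 := forall_placesOver_of_apply L v w hw (hval1 _ hu₀)
  -- the product structure of `A` in `R = R⁺ ⊕ R⁻`
  have hP1 : P ⊆ {a | Valued.v ((a : LocalRing L v) w) ≤ 1} := fun a ha => (hval1 _ ha).le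
  have hY1 : Y ⊆ {y | Valued.v ((y : LocalRing L v) w) ≤ 1} := fun y hy => (lt_of_le_of_lt hy hρ1).le
  have hAPY : ∀ (a : ↥(HeisRing.fixedPart (conjLocal L (IsCMField.complexConj L) v))) (y : ↥(HeisRing.skewPart (conjLocal L (IsCMField.complexConj L) v))),
      (a : LocalRing L v) + (y : LocalRing L v) ∈ A ↔ a ∈ P ∧ y ∈ Y := fun a y => by
    have ha : conjLocal L (IsCMField.complexConj L) v ((a : LocalRing L v) - 1) = (a : LocalRing L v) - 1 := by
      rw [map_sub, map_one, (HeisRing.mem_fixedPart_iff _ _).1 a.2]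
    have hmax := valued_add_apply_eq_max L v w hw h2w ha ((HeisRing.mem_skewPart_iff _ _).1 y.2)
    show Valued.v (((a : LocalRing L v) + (y : LocalRing L v) - 1) w) ≤ c ↔ _
    rw [show (a : LocalRing L v) + (y : LocalRing L v) - 1 = ((a : LocalRing L v) - 1) + (y : LocalRing L v) by ring, hmax, max_le_iff]
    rfl
  -- an additive Haar measure `μ⁺` on `R⁺` (transported from `μ⁻` by a skew unit) and the Haar measure `(μ⁺ ⊗ μ⁻) ∘ ringDecomp⁻¹` on `R`
  obtain ⟨δ, hδ⟩ := exists_conjLocal_skew_unit L v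
  set eP := HeisRing.mulSkewUnit (conjLocal L (IsCMField.complexConj L) v) δ hδ with hePdef
  set μP : Measure ↥(HeisRing.fixedPart (conjLocal L (IsCMField.complexConj L) v)) := μY.map eP.symm with hμPdef
  haveI hμP : μP.IsAddHaarMeasure := ContinuousAddEquiv.isAddHaarMeasure_map μY eP.symm
  haveI : (μP.prod μY).IsAddHaarMeasure := inferInstance
  haveI : ((μP.prod μY).map (HeisRing.ringDecomp (conjLocal L (IsCMField.complexConj L) v) (conjLocal_conjLocal_cm L v) hσc).symm).IsAddHaarMeasure :=
    ContinuousAddEquiv.isAddHaarMeasure_map (μP.prod μY) (HeisRing.ringDecomp (conjLocal L (IsCMField.complexConj L) v) (conjLocal_conjLocal_cm L v) hσc).symm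
  -- §1 orthogonality, §2 decomposition, §3 constancy of the fibre
  have horth := integral_indicator_dite_eq_zero_of_mul_mem_iff L v w hw
    ((μP.prod μY).map (HeisRing.ringDecomp (conjLocal L (IsCMField.complexConj L) v) (conjLocal_conjLocal_cm L v) hσc).symm) χ₁ h₁ u₀ hu₀' hχ hA hAu
  rw [integral_indicator_dite_map_ringDecomp_eq_of_prod L v w hw χ₁ h₁ μP μY hA hA1 hP1 hY1 hAPY] at horth
  have hfib : ∀ a : ↥(HeisRing.fixedPart (conjLocal L (IsCMField.complexConj L) v)),
      P.indicator (fun a' => ∫ y in Y, E ((a' : LocalRing L v) + (y : LocalRing L v)) ∂μY) a = P.indicator (fun _ => Φ) a := fun a => by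
    by_cases ha : a ∈ P
    · rw [Set.indicator_of_mem ha, Set.indicator_of_mem ha]
      exact setIntegral_skewBall_dite_add_eq_of_fixed L v w hw μY h2w χ₁ hfix ρ hρ1.le ((HeisRing.mem_fixedPart_iff _ _).1 a.2) (hval1 _ ha)
    · rw [Set.indicator_of_notMem ha, Set.indicator_of_notMem ha]
  have hPm : MeasurableSet P := measurable_subtype_coe hA
  rw [integral_congr_ae (Filter.Eventually.of_forall hfib), integral_indicator_const Φ hPm, Complex.real_smul] at horth
  -- `0 < μ⁺(P) < ∞`
  have hPo : IsOpen P := by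
    have h : P = (fun a : ↥(HeisRing.fixedPart (conjLocal L (IsCMField.complexConj L) v)) => ((a : LocalRing L v) - 1) w) ⁻¹'
        {z : w.1.adicCompletion L | Valued.v z ≤ c} := rfl
    rw [h]
    exact (isOpen_setOf_valued_le_valued L v w hρ0).preimage ((continuous_apply w).comp (continuous_subtype_val.sub continuous_const))
  have hPne : P.Nonempty := ⟨⟨1, (HeisRing.mem_fixedPart_iff _ _).2 (map_one _)⟩, by
    show Valued.v (((1 : LocalRing L v) - 1) w) ≤ c
    rw [sub_self, Pi.zero_apply, map_zero]; exact _root_.zero_le⟩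
  have hPfin : μP P ≠ ⊤ := by
    have hBPc : IsCompact {a : ↥(HeisRing.fixedPart (conjLocal L (IsCMField.complexConj L) v)) | Valued.v ((a : LocalRing L v) w) ≤ 1} :=
      (HeisRing.isClosed_fixedPart _ hσc).isClosedEmbedding_subtypeVal.isCompact_preimage (isCompact_setOf_valued_apply_le_one L v w hw)
    exact ((measure_mono hP1).trans_lt hBPc.measure_lt_top).ne
  have hPpos : (μP.real P : ℂ) ≠ 0 := by
    rw [Ne, Complex.ofReal_eq_zero, measureReal_def, ENNReal.toReal_eq_zero_iff, not_or]
    exact ⟨(hPo.measure_pos μP hPne).ne', hPfin⟩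
  exact (mul_eq_zero.1 horth).resolve_left hPpos

open scoped Classical in
include hw in
/-- **(iii) THE UNIT SKEW BALL AT POSITIVE DEPTH — `∫_{y ∈ R⁻, |y|_w ≤ 1} χ₁((1 + y)^) dμ⁻(y) = 0`** whenever `χ₁` has POSITIVE DEPTH (a unit `u₀` with `|(u₀ − 1)_w| < 1` and
`χ₁ u₀ ≠ 1` — :182's `hpos` read at the place `w`), for a continuous `χ₁` trivial on the `σ`-fixed units of absolute value one (`hfix`, = inert Branch B), `|2|_w = 1`, every regular
additive Haar measure `μ⁻` on `R⁻`.  At depth ZERO the same integral is `−χ₁(δ₀)·μ⁻(𝔪⁻) ≠ 0` (★ (II)-b2 p862267) — the `n = 1` versus `n ≥ 2` dichotomy of the shell `m = 0` of the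
positive-depth Casselman pair (p05 (g2) R0 §3 «`m = 0`: `= 0` for `n ≥ 2`»).  PROOF: PART 1 §1 on the `u₀`-invariant set `A′ = {b : |b_w| ≤ 1, |(b + σb)_w| = 1} = 𝒪⁺ˣ ⊕ 𝒪⁻`
(`u₀b + σ(u₀b) = (b + σb) + (tb + σ(tb))`, `t = u₀ − 1`, `|tb + σ(tb)|_w < 1`); §2 with `P = {|a_w| = 1}`, `Y = {|y_w| ≤ 1}` (`(a + y) + σ(a + y) = 2a`, `|a + y|_w = max`); §3 at
radius `|1| = 1`; `0 = μ⁺{|a| = 1}·Φ₁` and the unit sphere of `R⁺` is open, non-empty (`∋ 1`) and relatively compact. [cite: Keys1984, §4–§5, §7 Theorem (2) p. 126]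
[cite: WeilBNT1967, Ch. II §5] [cite: Roche1998, §3–§4] -/
theorem setIntegral_skewUnitBall_dite_one_add_eq_zero_of_posDepth (h2w : Valued.v (2 : w.1.adicCompletion L) = 1)
    (χ₁ : (LocalRing L v)ˣ →* ℂˣ) (h₁ : Continuous fun x => ((χ₁ x : ℂˣ) : ℂ))
    (hfix : ∀ u : (LocalRing L v)ˣ, (∀ w' : PlacesOver L v, Valued.v ((u : LocalRing L v) w') = 1) →
      conjLocal L (IsCMField.complexConj L) v (u : LocalRing L v) = u → χ₁ u = 1)
    (u₀ : (LocalRing L v)ˣ) (hu₀ : Valued.v (((u₀ : LocalRing L v) - 1) w) < 1) (hχ : χ₁ u₀ ≠ 1) :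
    ∫ y in {y : ↥(HeisRing.skewPart (conjLocal L (IsCMField.complexConj L) v)) | Valued.v ((y : LocalRing L v) w) ≤ 1},
        (fun r : LocalRing L v => if h : IsUnit r then ((χ₁ h.unit : ℂˣ) : ℂ) else 0) (1 + (y : LocalRing L v)) ∂μY = 0 := by
  letI : Invertible (2 : LocalRing L v) := (isUnit_two_localRing L v).invertible
  haveI : SecondCountableTopology (LocalRing L v) := secondCountableTopology_localRing (E := L) v
  have hσc := continuous_conjLocal L (IsCMField.complexConj L) v
  haveI := HeisRing.locallyCompactSpace_fixedPart (conjLocal L (IsCMField.complexConj L) v) hσc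
  haveI := HeisRing.locallyCompactSpace_skewPart (conjLocal L (IsCMField.complexConj L) v) hσc
  haveI : SecondCountableTopology ↥(HeisRing.fixedPart (conjLocal L (IsCMField.complexConj L) v)) := TopologicalSpace.Subtype.secondCountableTopology _
  haveI : SecondCountableTopology ↥(HeisRing.skewPart (conjLocal L (IsCMField.complexConj L) v)) := TopologicalSpace.Subtype.secondCountableTopology _
  -- names; the radius is `|1|_w = 1`
  set E : LocalRing L v → ℂ := fun r : LocalRing L v => if h : IsUnit r then ((χ₁ h.unit : ℂˣ) : ℂ) else 0 with hEdef
  have h1w : Valued.v ((1 : LocalRing L v) w) = 1 := by rw [Pi.one_apply, map_one]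
  set A : Set (LocalRing L v) := {b | Valued.v (b w) ≤ 1 ∧ Valued.v ((b + conjLocal L (IsCMField.complexConj L) v b) w) = 1} with hAdef
  set P : Set ↥(HeisRing.fixedPart (conjLocal L (IsCMField.complexConj L) v)) := {a | Valued.v ((a : LocalRing L v) w) = 1} with hPdef
  set Y : Set ↥(HeisRing.skewPart (conjLocal L (IsCMField.complexConj L) v)) := {y | Valued.v ((y : LocalRing L v) w) ≤ Valued.v ((1 : LocalRing L v) w)} with hYdef
  set Φ : ℂ := ∫ y in Y, E (1 + (y : LocalRing L v)) ∂μY with hΦdef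
  have hYeq : {y : ↥(HeisRing.skewPart (conjLocal L (IsCMField.complexConj L) v)) | Valued.v ((y : LocalRing L v) w) ≤ 1} = Y := by
    rw [hYdef, h1w]
  rw [hYeq]
  -- valuation bookkeeping
  have hσv : ∀ b : LocalRing L v, Valued.v ((conjLocal L (IsCMField.complexConj L) v b) w) = Valued.v (b w) :=
    fun b => valued_conjLocal_apply_of_smul_eq L v w hw b
  have hA1 : ∀ b ∈ A, Valued.v (b w) = 1 := fun b hb => by
    refine le_antisymm hb.1 ?_
    have h : Valued.v ((b + conjLocal L (IsCMField.complexConj L) v b) w) ≤ Valued.v (b w) := by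
      rw [Pi.add_apply]; exact (Valuation.map_add _ _ _).trans (max_le le_rfl (hσv b).le)
    exact hb.2 ▸ h
  have hunit1 : ∀ u : (LocalRing L v)ˣ, Valued.v (((u : LocalRing L v) - 1) w) < 1 → Valued.v ((u : LocalRing L v) w) = 1 := fun u hu => by
    have h : (u : LocalRing L v) w = 1 + ((u : LocalRing L v) - 1) w := by rw [Pi.sub_apply, Pi.one_apply, add_sub_cancel]
    rw [h]; exact Valuation.map_one_add_of_lt _ hu
  have hstep : ∀ (u : (LocalRing L v)ˣ) (b : LocalRing L v), Valued.v (((u : LocalRing L v) - 1) w) < 1 → b ∈ A → (u : LocalRing L v) * b ∈ A := fun u b hu hb => by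
    have hbv : Valued.v (b w) = 1 := hA1 b hb
    refine ⟨?_, ?_⟩
    · show Valued.v (((u : LocalRing L v) * b) w) ≤ 1
      rw [Pi.mul_apply, map_mul, hunit1 u hu, one_mul]; exact hb.1
    · show Valued.v (((u : LocalRing L v) * b + conjLocal L (IsCMField.complexConj L) v ((u : LocalRing L v) * b)) w) = 1
      have hsplit : (u : LocalRing L v) * b + conjLocal L (IsCMField.complexConj L) v ((u : LocalRing L v) * b) =
          (b + conjLocal L (IsCMField.complexConj L) v b) +
            (((u : LocalRing L v) - 1) * b + conjLocal L (IsCMField.complexConj L) v (((u : LocalRing L v) - 1) * b)) := by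
        rw [show (u : LocalRing L v) * b = b + ((u : LocalRing L v) - 1) * b by ring, map_add]; ring
      have hsmall : Valued.v ((((u : LocalRing L v) - 1) * b + conjLocal L (IsCMField.complexConj L) v (((u : LocalRing L v) - 1) * b)) w) < 1 := by
        rw [Pi.add_apply]
        refine lt_of_le_of_lt (Valuation.map_add _ _ _) (max_lt ?_ ?_)
        · rw [Pi.mul_apply, map_mul, hbv, mul_one]; exact hu
        · rw [hσv, Pi.mul_apply, map_mul, hbv, mul_one]; exact hu
      rw [hsplit, Pi.add_apply, Valuation.map_add_eq_of_lt_left _ (by rw [hb.2]; exact hsmall), hb.2]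
  have hu₀inv : Valued.v ((((u₀⁻¹ : (LocalRing L v)ˣ) : LocalRing L v) - 1) w) < 1 := by
    have h : (((u₀⁻¹ : (LocalRing L v)ˣ) : LocalRing L v) - 1) w = -((((u₀⁻¹ : (LocalRing L v)ˣ) : LocalRing L v) w) * (((u₀ : LocalRing L v) - 1) w)) := by
      have h1 := units_apply_mul_inv_apply L v u₀ w
      simp only [Pi.sub_apply, Pi.one_apply]
      linear_combination h1
    rw [h, Valuation.map_neg, map_mul, valued_units_inv_apply_eq_one L v (hunit1 _ hu₀), one_mul]; exact hu₀
  -- the set `A` is Borel and `u₀`-invariant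
  have hA : MeasurableSet A := by
    have h : A = {b : LocalRing L v | Valued.v (b w) ≤ 1} ∩
        (fun b : LocalRing L v => (b + conjLocal L (IsCMField.complexConj L) v b) w) ⁻¹' {z : w.1.adicCompletion L | Valued.v z = 1} := rfl
    rw [h]
    exact (isClosed_setOf_valued_apply_le_one L v w).measurableSet.inter
      (((isOpen_setOf_valued_eq_one L v w).preimage ((continuous_apply w).comp (continuous_id.add hσc))).measurableSet)
  have hAu : ∀ b : LocalRing L v, (u₀ : LocalRing L v) * b ∈ A ↔ b ∈ A := fun b => by
    refine ⟨fun h => ?_, fun h => hstep u₀ b hu₀ h⟩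
    have h' := hstep u₀⁻¹ ((u₀ : LocalRing L v) * b) hu₀inv h
    rwa [← mul_assoc, Units.inv_mul, one_mul] at h'
  have hu₀' : ∀ w' : PlacesOver L v, Valued.v ((u₀ : LocalRing L v) w') = 1 := forall_placesOver_of_apply L v w hw (hunit1 _ hu₀)
  -- the product structure of `A` in `R = R⁺ ⊕ R⁻`
  have hP1 : P ⊆ {a | Valued.v ((a : LocalRing L v) w) ≤ 1} := fun a ha => le_of_eq ha
  have hY1 : Y ⊆ {y | Valued.v ((y : LocalRing L v) w) ≤ 1} := fun y hy => by rw [← h1w]; exact hy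
  have hAPY : ∀ (a : ↥(HeisRing.fixedPart (conjLocal L (IsCMField.complexConj L) v))) (y : ↥(HeisRing.skewPart (conjLocal L (IsCMField.complexConj L) v))),
      (a : LocalRing L v) + (y : LocalRing L v) ∈ A ↔ a ∈ P ∧ y ∈ Y := fun a y => by
    have ha : conjLocal L (IsCMField.complexConj L) v (a : LocalRing L v) = a := (HeisRing.mem_fixedPart_iff _ _).1 a.2
    have hy : conjLocal L (IsCMField.complexConj L) v (y : LocalRing L v) = -(y : LocalRing L v) := (HeisRing.mem_skewPart_iff _ _).1 y.2
    have hmax := valued_add_apply_eq_max L v w hw h2w ha hy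
    have htr : Valued.v ((((a : LocalRing L v) + (y : LocalRing L v)) + conjLocal L (IsCMField.complexConj L) v ((a : LocalRing L v) + (y : LocalRing L v))) w) =
        Valued.v ((a : LocalRing L v) w) := by
      rw [map_add, ha, hy, show (a : LocalRing L v) + (y : LocalRing L v) + ((a : LocalRing L v) + -(y : LocalRing L v)) =
        (a : LocalRing L v) + (a : LocalRing L v) by ring, Pi.add_apply, ← two_mul, map_mul, h2w, one_mul]
    show (Valued.v (((a : LocalRing L v) + (y : LocalRing L v)) w) ≤ 1 ∧ _) ↔ (Valued.v ((a : LocalRing L v) w) = 1 ∧ Valued.v ((y : LocalRing L v) w) ≤ Valued.v ((1 : LocalRing L v) w))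
    rw [htr, hmax, h1w, max_le_iff]
    exact ⟨fun h => ⟨h.2, h.1.2⟩, fun h => ⟨⟨le_of_eq h.1, h.2⟩, h.1⟩⟩
  -- `μ⁺` and the Haar measure on `R`
  obtain ⟨δ, hδ⟩ := exists_conjLocal_skew_unit L v
  set eP := HeisRing.mulSkewUnit (conjLocal L (IsCMField.complexConj L) v) δ hδ with hePdef
  set μP : Measure ↥(HeisRing.fixedPart (conjLocal L (IsCMField.complexConj L) v)) := μY.map eP.symm with hμPdef
  haveI hμP : μP.IsAddHaarMeasure := ContinuousAddEquiv.isAddHaarMeasure_map μY eP.symm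
  haveI : (μP.prod μY).IsAddHaarMeasure := inferInstance
  haveI : ((μP.prod μY).map (HeisRing.ringDecomp (conjLocal L (IsCMField.complexConj L) v) (conjLocal_conjLocal_cm L v) hσc).symm).IsAddHaarMeasure :=
    ContinuousAddEquiv.isAddHaarMeasure_map (μP.prod μY) (HeisRing.ringDecomp (conjLocal L (IsCMField.complexConj L) v) (conjLocal_conjLocal_cm L v) hσc).symm
  -- §1, §2, §3 (radius `|1| = 1`)
  have horth := integral_indicator_dite_eq_zero_of_mul_mem_iff L v w hw
    ((μP.prod μY).map (HeisRing.ringDecomp (conjLocal L (IsCMField.complexConj L) v) (conjLocal_conjLocal_cm L v) hσc).symm) χ₁ h₁ u₀ hu₀' hχ hA hAu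
  rw [integral_indicator_dite_map_ringDecomp_eq_of_prod L v w hw χ₁ h₁ μP μY hA hA1 hP1 hY1 hAPY] at horth
  have hfib : ∀ a : ↥(HeisRing.fixedPart (conjLocal L (IsCMField.complexConj L) v)),
      P.indicator (fun a' => ∫ y in Y, E ((a' : LocalRing L v) + (y : LocalRing L v)) ∂μY) a = P.indicator (fun _ => Φ) a := fun a => by
    by_cases ha : a ∈ P
    · rw [Set.indicator_of_mem ha, Set.indicator_of_mem ha]
      exact setIntegral_skewBall_dite_add_eq_of_fixed L v w hw μY h2w χ₁ hfix 1 h1w.le ((HeisRing.mem_fixedPart_iff _ _).1 a.2) ha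
    · rw [Set.indicator_of_notMem ha, Set.indicator_of_notMem ha]
  have hPm : MeasurableSet P := measurable_subtype_coe (measurableSet_setOf_valued_apply_eq_one L v w)
  rw [integral_congr_ae (Filter.Eventually.of_forall hfib), integral_indicator_const Φ hPm, Complex.real_smul] at horth
  -- `0 < μ⁺(P) < ∞`: the unit sphere of `R⁺` is open, contains `1`, and lies in the compact unit ball
  have hPo : IsOpen P := by
    have h : P = (fun a : ↥(HeisRing.fixedPart (conjLocal L (IsCMField.complexConj L) v)) => (a : LocalRing L v) w) ⁻¹' {z : w.1.adicCompletion L | Valued.v z = 1} := rfl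
    rw [h]
    exact (isOpen_setOf_valued_eq_one L v w).preimage ((continuous_apply w).comp continuous_subtype_val)
  have hPne : P.Nonempty := ⟨⟨1, (HeisRing.mem_fixedPart_iff _ _).2 (map_one _)⟩, h1w⟩
  have hPfin : μP P ≠ ⊤ := by
    have hBPc : IsCompact {a : ↥(HeisRing.fixedPart (conjLocal L (IsCMField.complexConj L) v)) | Valued.v ((a : LocalRing L v) w) ≤ 1} :=
      (HeisRing.isClosed_fixedPart _ hσc).isClosedEmbedding_subtypeVal.isCompact_preimage (isCompact_setOf_valued_apply_le_one L v w hw)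
    exact ((measure_mono hP1).trans_lt hBPc.measure_lt_top).ne
  have hPpos : (μP.real P : ℂ) ≠ 0 := by
    rw [Ne, Complex.ofReal_eq_zero, measureReal_def, ENNReal.toReal_eq_zero_iff, not_or]
    exact ⟨(hPo.measure_pos μP hPne).ne', hPfin⟩
  exact (mul_eq_zero.1 horth).resolve_left hPpos

/-! ## §5 The `χ₁⁻¹` readings (the (II)-b2 head and the memo's `χ₁(σz)⁻¹` integrands) -/

omit [MeasurableSpace (LocalRing L v)] [BorelSpace (LocalRing L v)] in
/-- The letters are inversion-stable: continuity, «trivial on the `σ`-fixed units of absolute value one», and the depth witness pass from `χ₁` to `χ₁⁻¹`. [cite: WeilBNT1967, Ch. II §5] -/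
theorem inv_letters (χ₁ : (LocalRing L v)ˣ →* ℂˣ) (h₁ : Continuous fun x => ((χ₁ x : ℂˣ) : ℂ))
    (hfix : ∀ u : (LocalRing L v)ˣ, (∀ w' : PlacesOver L v, Valued.v ((u : LocalRing L v) w') = 1) →
      conjLocal L (IsCMField.complexConj L) v (u : LocalRing L v) = u → χ₁ u = 1)
    (u₀ : (LocalRing L v)ˣ) (hχ : χ₁ u₀ ≠ 1) :
    (Continuous fun x => ((χ₁⁻¹ x : ℂˣ) : ℂ)) ∧
      (∀ u : (LocalRing L v)ˣ, (∀ w' : PlacesOver L v, Valued.v ((u : LocalRing L v) w') = 1) →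
        conjLocal L (IsCMField.complexConj L) v (u : LocalRing L v) = u → χ₁⁻¹ u = 1) ∧
      χ₁⁻¹ u₀ ≠ 1 := by
  refine ⟨?_, fun u hu hσu => by rw [MonoidHom.inv_apply, hfix u hu hσu, inv_one], by rwa [MonoidHom.inv_apply, Ne, inv_eq_one]⟩
  have h : (fun x => ((χ₁⁻¹ x : ℂˣ) : ℂ)) = fun x => (((χ₁ x : ℂˣ) : ℂ))⁻¹ := by
    funext x; rw [MonoidHom.inv_apply, Units.val_inv_eq_inv_val]
  rw [h]
  exact h₁.inv₀ fun x => Units.ne_zero _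

open scoped Classical in
include hw in
/-- **(i⁻) `∫_{y ∈ R⁻, |y|_w ≤ |ρ|_w} χ₁((1 + y)^)⁻¹ dμ⁻(y) = 0`** under the hypotheses of (i) (§4 applied to `χ₁⁻¹`, §5 `inv_letters`). [cite: Keys1984, §4–§5, §7 Theorem (2) p. 126] -/
theorem setIntegral_skewBall_diteInv_one_add_eq_zero_of_level (h2w : Valued.v (2 : w.1.adicCompletion L) = 1)
    (χ₁ : (LocalRing L v)ˣ →* ℂˣ) (h₁ : Continuous fun x => ((χ₁ x : ℂˣ) : ℂ))
    (hfix : ∀ u : (LocalRing L v)ˣ, (∀ w' : PlacesOver L v, Valued.v ((u : LocalRing L v) w') = 1) →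
      conjLocal L (IsCMField.complexConj L) v (u : LocalRing L v) = u → χ₁ u = 1)
    (ρ : LocalRing L v) (hρ0 : Valued.v (ρ w) ≠ 0) (hρ1 : Valued.v (ρ w) < 1)
    (u₀ : (LocalRing L v)ˣ) (hu₀ : Valued.v (((u₀ : LocalRing L v) - 1) w) ≤ Valued.v (ρ w)) (hχ : χ₁ u₀ ≠ 1) :
    ∫ y in {y : ↥(HeisRing.skewPart (conjLocal L (IsCMField.complexConj L) v)) | Valued.v ((y : LocalRing L v) w) ≤ Valued.v (ρ w)},
        (fun r : LocalRing L v => if h : IsUnit r then (((χ₁ h.unit)⁻¹ : ℂˣ) : ℂ) else 0) (1 + (y : LocalRing L v)) ∂μY = 0 := by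
  obtain ⟨h₁', hfix', hχ'⟩ := inv_letters L v χ₁ h₁ hfix u₀ hχ
  exact setIntegral_skewBall_dite_one_add_eq_zero_of_level L v w hw μY h2w χ₁⁻¹ h₁' hfix' ρ hρ0 hρ1 u₀ hu₀ hχ'

open scoped Classical in
include hw in
/-- **(iii⁻) `∫_{y ∈ R⁻, |y|_w ≤ 1} χ₁((1 + y)^)⁻¹ dμ⁻(y) = 0`** under the hypotheses of (iii) — the POSITIVE-DEPTH value of the (II)-b2 head integral (which at depth zero is
`−χ₁(δ₀)·μ⁻(𝔪⁻)`, ★ p862267). [cite: Keys1984, §4–§5, §7 Theorem (2) p. 126] -/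
theorem setIntegral_skewUnitBall_diteInv_one_add_eq_zero_of_posDepth (h2w : Valued.v (2 : w.1.adicCompletion L) = 1)
    (χ₁ : (LocalRing L v)ˣ →* ℂˣ) (h₁ : Continuous fun x => ((χ₁ x : ℂˣ) : ℂ))
    (hfix : ∀ u : (LocalRing L v)ˣ, (∀ w' : PlacesOver L v, Valued.v ((u : LocalRing L v) w') = 1) →
      conjLocal L (IsCMField.complexConj L) v (u : LocalRing L v) = u → χ₁ u = 1)
    (u₀ : (LocalRing L v)ˣ) (hu₀ : Valued.v (((u₀ : LocalRing L v) - 1) w) < 1) (hχ : χ₁ u₀ ≠ 1) :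
    ∫ y in {y : ↥(HeisRing.skewPart (conjLocal L (IsCMField.complexConj L) v)) | Valued.v ((y : LocalRing L v) w) ≤ 1},
        (fun r : LocalRing L v => if h : IsUnit r then (((χ₁ h.unit)⁻¹ : ℂˣ) : ℂ) else 0) (1 + (y : LocalRing L v)) ∂μY = 0 := by
  obtain ⟨h₁', hfix', hχ'⟩ := inv_letters L v χ₁ h₁ hfix u₀ hχ
  exact setIntegral_skewUnitBall_dite_one_add_eq_zero_of_posDepth L v w hw μY h2w χ₁⁻¹ h₁' hfix' u₀ hu₀ hχ'

end SkewBall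

end Summit.HodgeConjecture.HodgeConjecture.R90.S1.BposSkewLineCharacterIntegralDepth

end
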